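import Summits.ResolutionOfSingularities.ResolutionOfSingularities.Theorems.WeightedInvariantLocalWeightedDropMonomialPhaseChart
import Summits.ResolutionOfSingularities.ResolutionOfSingularities.Theorems.WeightedInvariantLocalWeightedDropMonomialPhase

/-!
# TOT rung R6 (toric / Newton non-degenerate), step (b): the chart calculus of a TORIC MOVE of the count game

Crux item stmt-ResolutionOfSingularities-8899 `WeightedInvariant.LocalWeightedDrop` (route `ResolutionOfSingularities/WeightedInvariant`), line
`nc-game-transport` (strategist res-L1-w43-strat-1), TOT rung R6 `NCTransport.TOTRungNonDegenerate` (tree file `…NCToricRung`, the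
strategist's sketch 5d6b0cd95af99ede).  [OURS · L1 W4.3 · seat res-D-pv-006; def-free helper algebra for `NCTransport.ToricStep`; NOT a statement
of any manuscript.]

A toric move of the count game blows up the centre `{x_j = 0 : j ∈ J}` (identity coordinate change, indicator weight of `J`); the opponent answers
with an exceptional point `c` supported on `J`, the mover slices at a live slot `l` (`c_l ≠ 0`).  The composite substitution is
`θ_t := slice_l (chart_t)`:  `θ_l = c_l · s`,  `θ_{l⁺(q)} = s^{[l⁺(q) ∈ J]} · (c_{l⁺(q)} + y_q)`  (`s = X 0`, `y_q = X q.succ`, `l⁺ = l.succAbove`).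
This file provides:
* `coeff_single_mul`, `logCoeff_mul/pow/prod` — the linear coefficient of a product and the additivity of the LOGARITHMIC COEFFICIENT
  `f ↦ [X_t] f · f(0)⁻¹` (the entries of the log-Jacobian matrix of a `ToricState`);
* `coeff_single_subst_eq_sum_of_constantCoeff_zero` — the linear part of a composition (folklore; same computation as route WildCones'
  `CampaignW46.HypersurfacesCharTwo.coeff_single_subst_eq_sum`, re-proved here to keep the import closure inside W4.3);
* `slice_chart_apply/self/succAbove`, `constantCoeff_slice_chart`, `slice_subst_chart` (`slice_l ∘ chart = θ` as substitutions),
  `coeff_single_succ_slice_chart`, `coeff_single_succ_subst_slice_chart` (linear coefficients through `θ`: a `y_q`-linear term survives only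
  from an untouched slot `l⁺(q) ∉ J`);
* `prod_slice_linear_pow`, `prod_slice_chart_pow` — THE PRODUCT FORMULA `∏_t θ_t^{e_t} = U(e) · ∏_{t′} X_{t′}^{e′_{t′}}` with the unit
  `U(e) = c_l^{e_l} · ∏_{c_{l⁺(q)} ≠ 0} (c_{l⁺(q)} + y_q)^{e_{l⁺(q)}}` and the new exponents `e′ = (Σ_{t∈J} e_t ; e_{l⁺(q)}·[c_{l⁺(q)} = 0])`;
  `constantCoeff_unitPart`, `logCoeff_unitPart` (its log coefficients: `e_{l⁺(q)} / c_{l⁺(q)}` on the translated slots, `0` elsewhere);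
* `isUnit_det_of_rowOps` — the determinant bookkeeping of the move: new matrix = (row scaling) · (row permutation) · (add rows into row `l`).
-/

set_option linter.dupNamespace false -- mandated namespace of this single-conjunct summit

namespace Summit.ResolutionOfSingularities.ResolutionOfSingularities.Theorems

namespace NCTransport

open MvPowerSeries Literature.AlgebraicGeometry.Resolution

variable {k : Type} [Field k]

/-! ## 1. Linear coefficients of products; logarithmic coefficients -/

/-- The linear coefficient of a product: `[X_t](f·g) = [X_t]f · g(0) + f(0) · [X_t]g`. -/
theorem coeff_single_mul {N : ℕ} (t : Fin N) (f g : MvPowerSeries (Fin N) k) :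
    coeff (Finsupp.single t 1) (f * g) =
      coeff (Finsupp.single t 1) f * constantCoeff g + constantCoeff f * coeff (Finsupp.single t 1) g := by
  classical
  rw [coeff_mul, Finsupp.antidiagonal_single, Finset.sum_map, Finset.Nat.sum_antidiagonal_succ,
    Finset.Nat.antidiagonal_zero, Finset.sum_singleton]
  simp only [Function.Embedding.coe_prodMap, Function.Embedding.coeFn_mk, Prod.map_apply, Finsupp.single_zero,
    coeff_zero_eq_constantCoeff_apply, zero_add]
  ring

/-- ADDITIVITY OF THE LOGARITHMIC COEFFICIENT on series with non-zero constant term. -/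
theorem logCoeff_mul {N : ℕ} (t : Fin N) {f g : MvPowerSeries (Fin N) k} (hf : constantCoeff f ≠ 0)
    (hg : constantCoeff g ≠ 0) :
    coeff (Finsupp.single t 1) (f * g) * (constantCoeff (f * g))⁻¹ =
      coeff (Finsupp.single t 1) f * (constantCoeff f)⁻¹ + coeff (Finsupp.single t 1) g * (constantCoeff g)⁻¹ := by
  rw [coeff_single_mul, map_mul]
  field_simp

/-- The logarithmic coefficient of a power. -/
theorem logCoeff_pow {N : ℕ} (t : Fin N) {f : MvPowerSeries (Fin N) k} (hf : constantCoeff f ≠ 0) (n : ℕ) :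
    coeff (Finsupp.single t 1) (f ^ n) * (constantCoeff (f ^ n))⁻¹ =
      (n : k) * (coeff (Finsupp.single t 1) f * (constantCoeff f)⁻¹) := by
  classical
  induction n with
  | zero =>
    rw [pow_zero, coeff_one, if_neg (Finsupp.single_ne_zero.mpr one_ne_zero), zero_mul, Nat.cast_zero, zero_mul]
  | succ n ih =>
    rw [pow_succ, logCoeff_mul t (by rw [map_pow]; exact pow_ne_zero _ hf) hf, ih]
    push_cast
    ring

/-- The logarithmic coefficient of a finite product. -/
theorem logCoeff_prod {N : ℕ} {ι : Type} [DecidableEq ι] (t : Fin N) (s : Finset ι) {f : ι → MvPowerSeries (Fin N) k}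
    (hf : ∀ i ∈ s, constantCoeff (f i) ≠ 0) :
    coeff (Finsupp.single t 1) (∏ i ∈ s, f i) * (constantCoeff (∏ i ∈ s, f i))⁻¹ =
      ∑ i ∈ s, coeff (Finsupp.single t 1) (f i) * (constantCoeff (f i))⁻¹ := by
  classical
  induction s using Finset.induction_on with
  | empty =>
    rw [Finset.prod_empty, Finset.sum_empty, coeff_one, if_neg (Finsupp.single_ne_zero.mpr one_ne_zero), zero_mul]
  | insert a s ha ih =>
    have hs : ∀ i ∈ s, constantCoeff (f i) ≠ 0 := fun i hi => hf i (Finset.mem_insert_of_mem hi)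
    have hprod : constantCoeff (∏ i ∈ s, f i) ≠ 0 := by
      rw [map_prod]; exact Finset.prod_ne_zero_iff.mpr hs
    rw [Finset.prod_insert ha, Finset.sum_insert ha, logCoeff_mul t (hf a (Finset.mem_insert_self a s)) hprod, ih hs]

/-- The logarithmic coefficient of a constant vanishes. -/
theorem logCoeff_C {N : ℕ} (t : Fin N) (r : k) :
    coeff (Finsupp.single t 1) (C r : MvPowerSeries (Fin N) k) * (constantCoeff (C r : MvPowerSeries (Fin N) k))⁻¹ = 0 := by
  classical
  rw [coeff_C, if_neg (Finsupp.single_ne_zero.mpr one_ne_zero), zero_mul]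

/-- The logarithmic coefficient of the translated variable `c + X s`: `c⁻¹` at `s`, `0` elsewhere (also for `c = 0`, as `0⁻¹ = 0`). -/
theorem logCoeff_C_add_X {N : ℕ} (t s : Fin N) (r : k) :
    coeff (Finsupp.single t 1) (C r + X s : MvPowerSeries (Fin N) k) * (constantCoeff (C r + X s : MvPowerSeries (Fin N) k))⁻¹ =
      if t = s then r⁻¹ else 0 := by
  classical
  rw [map_add, map_add, coeff_C, if_neg (Finsupp.single_ne_zero.mpr one_ne_zero), zero_add, coeff_index_single_X,
    constantCoeff_C, constantCoeff_X, add_zero]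
  split_ifs <;> simp

/-! ## 2. The linear part of a composition -/

/-- THE LINEAR PART OF A SUBSTITUTION without constant terms: `[X_s](g∘θ) = Σ_t [X_t]g · [X_s]θ_t`. [folklore; re-proved, cf. the module
docstring] -/
theorem coeff_single_subst_eq_sum_of_constantCoeff_zero {N : ℕ} {θ : Fin N → MvPowerSeries (Fin N) k}
    (h0 : ∀ s, constantCoeff (θ s) = 0) (g : MvPowerSeries (Fin N) k) (s : Fin N) :
    coeff (Finsupp.single s 1) (subst θ g) =
      ∑ t, coeff (Finsupp.single t 1) g * coeff (Finsupp.single s 1) (θ t) := by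
  classical
  have hθ : HasSubst θ := hasSubst_of_constantCoeff_zero h0
  -- split `g` into constant part, linear part and a remainder of order `≥ 2`
  set g₂ := g - C (constantCoeff g) - ∑ t, C (coeff (Finsupp.single t 1) g) * X t with hg₂
  have hsplit : g = C (constantCoeff g) + ∑ t, C (coeff (Finsupp.single t 1) g) * X t + g₂ := by
    rw [hg₂]; ring
  have hlinX : ∀ u t : Fin N, coeff (Finsupp.single u 1) (C (coeff (Finsupp.single t 1) g) * X t :
      MvPowerSeries (Fin N) k) = if u = t then coeff (Finsupp.single t 1) g else 0 := by
    intro u t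
    rw [coeff_C_mul, coeff_index_single_X]
    split_ifs <;> simp
  have h2 : 2 ≤ g₂.order := by
    rw [FormalCoordChange.two_le_order_iff]
    refine ⟨?_, fun u => ?_⟩
    · rw [hg₂, map_sub, map_sub, map_sum, constantCoeff_C]
      simp
    · rw [hg₂, map_sub, map_sub, map_sum, coeff_C, if_neg (Finsupp.single_ne_zero.mpr one_ne_zero)]
      simp_rw [hlinX]
      rw [Finset.sum_ite_eq Finset.univ u, if_pos (Finset.mem_univ u)]
      ring
  have h2' : 2 ≤ (subst θ g₂).order := FormalCoordChange.two_le_order_subst θ h0 g₂ h2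
  have hrem : coeff (Finsupp.single s 1) (subst θ g₂) = 0 :=
    ((FormalCoordChange.two_le_order_iff _).mp h2').2 s
  conv_lhs => rw [hsplit]
  rw [subst_add hθ, subst_add hθ, map_add, map_add, hrem, add_zero, subst_C, coeff_C,
    if_neg (Finsupp.single_ne_zero.mpr one_ne_zero), zero_add, ← coe_substAlgHom hθ, map_sum,
    map_sum]
  refine Finset.sum_congr rfl fun t _ => ?_
  rw [map_mul, coe_substAlgHom hθ, subst_C, subst_X hθ, coeff_C_mul]

/-! ## 3. The composite substitution `θ = slice_l ∘ chart` -/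

/-- `θ_t = s^{w_t} · (c_t + slice_l y′_t)`. -/
theorem slice_chart_apply {m : ℕ} (w : Fin (m + 1) → ℕ) (c : Fin (m + 1) → k) (l t : Fin (m + 1)) :
    TupleGame.slice l (CobordantChart.chart w c t) =
      X 0 ^ w t * (C (c t) + TupleGame.slice l (X t.succ : MvPowerSeries (Fin (m + 1 + 1)) k)) := by
  rw [CobordantChart.chart_apply, TupleMonomialPhase.slice_mul, TupleMonomialPhase.slice_pow, TupleMonomialPhase.slice_X_zero,
    TupleMonomialPhase.slice_add, TupleMonomialPhase.slice_C]

/-- `θ_l = s^{w_l} · c_l` (the sliced slot). -/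
theorem slice_chart_self {m : ℕ} (w : Fin (m + 1) → ℕ) (c : Fin (m + 1) → k) (l : Fin (m + 1)) :
    TupleGame.slice l (CobordantChart.chart w c l) = X 0 ^ w l * C (c l) := by
  rw [slice_chart_apply, TupleMonomialPhase.slice_X_succ_self, add_zero]

/-- `θ_{l⁺(q)} = s^{w} · (c + y_q)` (the other slots, renumbered). -/
theorem slice_chart_succAbove {m : ℕ} (w : Fin (m + 1) → ℕ) (c : Fin (m + 1) → k) (l : Fin (m + 1)) (q : Fin m) :
    TupleGame.slice l (CobordantChart.chart w c (l.succAbove q)) =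
      X 0 ^ w (l.succAbove q) * (C (c (l.succAbove q)) + X q.succ) := by
  rw [slice_chart_apply, TupleMonomialPhase.slice_X_succ_succAbove]

/-- `θ_t(0) = 0`. -/
theorem constantCoeff_slice_chart {m : ℕ} (w : Fin (m + 1) → ℕ) (c : Fin (m + 1) → k) (hc : ∀ i, w i = 0 → c i = 0)
    (l t : Fin (m + 1)) : constantCoeff (TupleGame.slice l (CobordantChart.chart w c t)) = 0 := by
  rw [TupleMonomialPhase.constantCoeff_slice, CobordantArc.constantCoeff_chart w c hc]

/-- `θ` is substitutable. -/
theorem hasSubst_slice_chart {m : ℕ} (w : Fin (m + 1) → ℕ) (c : Fin (m + 1) → k) (hc : ∀ i, w i = 0 → c i = 0)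
    (l : Fin (m + 1)) : HasSubst (fun t => TupleGame.slice l (CobordantChart.chart w c t)) :=
  hasSubst_of_constantCoeff_zero fun t => constantCoeff_slice_chart w c hc l t

/-- A substitution through `θ` does not change constant coefficients. -/
theorem constantCoeff_subst_slice_chart {m : ℕ} (w : Fin (m + 1) → ℕ) (c : Fin (m + 1) → k) (hc : ∀ i, w i = 0 → c i = 0)
    (l : Fin (m + 1)) (F : MvPowerSeries (Fin (m + 1)) k) :
    constantCoeff (subst (fun t => TupleGame.slice l (CobordantChart.chart w c t)) F) = constantCoeff F :=
  constantCoeff_subst_of_constantCoeff_zero _ (fun t => constantCoeff_slice_chart w c hc l t) F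

/-- `slice_l (F∘chart) = F∘θ`: slicing after the chart is the substitution `θ`. -/
theorem slice_subst_chart {m : ℕ} (w : Fin (m + 1) → ℕ) (c : Fin (m + 1) → k) (hc : ∀ i, w i = 0 → c i = 0)
    (l : Fin (m + 1)) (F : MvPowerSeries (Fin (m + 1)) k) :
    TupleGame.slice l (subst (CobordantChart.chart w c) F) =
      subst (fun t => TupleGame.slice l (CobordantChart.chart w c t)) F := by
  unfold TupleGame.slice
  rw [subst_comp_subst_apply (CobordantChart.hasSubst_chart w c hc) (CobordantChartPlaneSlice.hasSubst_slice l)]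

/-- LINEAR COEFFICIENTS OF `θ_t` IN THE NEW VARIABLE `y_q` (indicator weight of `J`): only an untouched slot `t = l⁺(q) ∉ J` has one. -/
theorem coeff_single_succ_slice_chart {m : ℕ} (J : Finset (Fin (m + 1))) (c : Fin (m + 1) → k)
    (hc : ∀ i, (if i ∈ J then 1 else 0) = 0 → c i = 0) (l : Fin (m + 1)) (q : Fin m) (t : Fin (m + 1)) :
    coeff (Finsupp.single q.succ 1) (TupleGame.slice l (CobordantChart.chart (fun i => if i ∈ J then 1 else 0) c t)) =
      if t ∈ J then 0 else if t = l.succAbove q then 1 else 0 := by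
  classical
  by_cases ht : t ∈ J
  · rw [if_pos ht, slice_chart_apply, if_pos ht, pow_one]
    refine X_dvd_iff.mp (dvd_mul_right (X 0) _) _ ?_
    rw [Finsupp.single_apply, if_neg (Fin.succ_ne_zero q)]
  · rw [if_neg ht, slice_chart_apply, if_neg ht, pow_zero, one_mul, hc t (if_neg ht), map_zero, zero_add]
    by_cases htl : t = l
    · subst htl
      rw [TupleMonomialPhase.slice_X_succ_self, map_zero, if_neg (Fin.succAbove_ne t q).symm]
    · obtain ⟨q', rfl⟩ := Fin.exists_succAbove_eq htl
      rw [TupleMonomialPhase.slice_X_succ_succAbove, coeff_X]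
      by_cases hqq : q' = q
      · subst hqq; rw [if_pos rfl, if_pos rfl]
      · rw [if_neg (fun h => hqq (Fin.succ_injective _ ((Finsupp.single_left_inj one_ne_zero).mp h)).symm),
          if_neg (fun h => hqq (Fin.succAbove_right_injective h))]

/-- LINEAR COEFFICIENTS THROUGH `θ`: `[y_q](f∘θ) = [x_{l⁺(q)}] f` if the slot `l⁺(q)` is untouched (`∉ J`), and `0` otherwise (every
occurrence of a blown-up variable carries a factor `s`). -/
theorem coeff_single_succ_subst_slice_chart {m : ℕ} (J : Finset (Fin (m + 1))) (c : Fin (m + 1) → k)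
    (hc : ∀ i, (if i ∈ J then 1 else 0) = 0 → c i = 0) (l : Fin (m + 1)) (f : MvPowerSeries (Fin (m + 1)) k) (q : Fin m) :
    coeff (Finsupp.single q.succ 1) (subst (fun t => TupleGame.slice l (CobordantChart.chart (fun i => if i ∈ J then 1 else 0) c t)) f) =
      if l.succAbove q ∈ J then 0 else coeff (Finsupp.single (l.succAbove q) 1) f := by
  classical
  rw [coeff_single_subst_eq_sum_of_constantCoeff_zero (fun t => constantCoeff_slice_chart _ c hc l t)]
  simp_rw [coeff_single_succ_slice_chart J c hc l q]
  rw [Finset.sum_eq_single (l.succAbove q) (fun t _ ht => by rw [if_neg ht, ite_self, mul_zero])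
    (fun h => absurd (Finset.mem_univ _) h), if_pos rfl]
  split_ifs <;> simp

/-! ## 4. The product formula -/

open scoped Classical in
/-- THE SLICED TRANSLATED MONOMIAL: `∏_t (c_t + slice_l y′_t)^{e_t} = U(e) · ∏_q y_q^{e_{l⁺(q)}·[c_{l⁺(q)} = 0]` with the unit
`U(e) = c_l^{e_l} · ∏_{q : c_{l⁺(q)} ≠ 0} (c_{l⁺(q)} + y_q)^{e_{l⁺(q)}}`. -/
theorem prod_slice_linear_pow {m : ℕ} (c : Fin (m + 1) → k) (l : Fin (m + 1)) (e : Fin (m + 1) → ℕ) :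
    (∏ t, (C (c t) + TupleGame.slice l (X t.succ : MvPowerSeries (Fin (m + 1 + 1)) k)) ^ e t) =
      (C (c l) ^ e l * ∏ q : Fin m, (if c (l.succAbove q) = 0 then (1 : MvPowerSeries (Fin (m + 1)) k)
          else C (c (l.succAbove q)) + X q.succ) ^ e (l.succAbove q)) *
        ∏ q : Fin m, (X q.succ : MvPowerSeries (Fin (m + 1)) k) ^ (if c (l.succAbove q) = 0 then e (l.succAbove q) else 0) := by
  classical
  rw [Fin.prod_univ_succAbove _ l]
  have hl : (C (c l) + TupleGame.slice l (X l.succ : MvPowerSeries (Fin (m + 1 + 1)) k)) ^ e l = C (c l) ^ e l := by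
    rw [TupleMonomialPhase.slice_X_succ_self, add_zero]
  have hq : ∀ q : Fin m, (C (c (l.succAbove q)) + TupleGame.slice l (X (l.succAbove q).succ : MvPowerSeries (Fin (m + 1 + 1)) k))
      ^ e (l.succAbove q) =
      (if c (l.succAbove q) = 0 then (1 : MvPowerSeries (Fin (m + 1)) k) else C (c (l.succAbove q)) + X q.succ) ^ e (l.succAbove q) *
        X q.succ ^ (if c (l.succAbove q) = 0 then e (l.succAbove q) else 0) := by
    intro q
    rw [TupleMonomialPhase.slice_X_succ_succAbove]
    split_ifs with h0
    · rw [h0, map_zero, zero_add, one_pow, one_mul]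
    · rw [pow_zero, mul_one]
  simp_rw [hl, hq]
  rw [Finset.prod_mul_distrib]
  ring

/-- Repackaging a monomial in `s` and the `y_q` as a monomial over `Fin (m + 1)` with `Fin.cases` exponents. -/
theorem X_pow_mul_prod_succ_eq {m : ℕ} (N : ℕ) (f : Fin m → ℕ) :
    (X 0 : MvPowerSeries (Fin (m + 1)) k) ^ N * ∏ q : Fin m, (X q.succ : MvPowerSeries (Fin (m + 1)) k) ^ f q =
      ∏ t, (X t : MvPowerSeries (Fin (m + 1)) k) ^ (Fin.cases N f t : ℕ) := by
  rw [Fin.prod_univ_succ]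
  simp only [Fin.cases_zero, Fin.cases_succ]

open scoped Classical in
/-- THE PRODUCT FORMULA FOR A TORIC MOVE: `∏_t θ_t^{e_t} = U(e) · ∏_{t′} X_{t′}^{e′_{t′}}` with `e′ = (Σ_{t∈J} e_t ; e_{l⁺(q)}·[c_{l⁺(q)} = 0])`. -/
theorem prod_slice_chart_pow {m : ℕ} (J : Finset (Fin (m + 1))) (c : Fin (m + 1) → k) (l : Fin (m + 1)) (e : Fin (m + 1) → ℕ) :
    (∏ t, TupleGame.slice l (CobordantChart.chart (fun i => if i ∈ J then 1 else 0) c t) ^ e t) =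
      (C (c l) ^ e l * ∏ q : Fin m, (if c (l.succAbove q) = 0 then (1 : MvPowerSeries (Fin (m + 1)) k)
          else C (c (l.succAbove q)) + X q.succ) ^ e (l.succAbove q)) *
        ∏ t, (X t : MvPowerSeries (Fin (m + 1)) k) ^
          (Fin.cases (∑ t ∈ J, e t) (fun q => if c (l.succAbove q) = 0 then e (l.succAbove q) else 0) t : ℕ) := by
  classical
  have hsum : ∑ t, (if t ∈ J then 1 else 0) * e t = ∑ t ∈ J, e t := by
    simp_rw [ite_mul, one_mul, zero_mul]
    rw [← Finset.sum_filter, Finset.filter_mem_eq_inter, Finset.univ_inter]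
  simp_rw [slice_chart_apply, mul_pow, ← pow_mul]
  rw [Finset.prod_mul_distrib, Finset.prod_pow_eq_pow_sum, hsum, prod_slice_linear_pow c l e, ← X_pow_mul_prod_succ_eq]
  ring

open scoped Classical in
/-- The unit `U(e)` has non-zero constant term (`c_l ≠ 0`). -/
theorem constantCoeff_unitPart {m : ℕ} (c : Fin (m + 1) → k) {l : Fin (m + 1)} (hcl : c l ≠ 0) (e : Fin (m + 1) → ℕ) :
    constantCoeff (C (c l) ^ e l * ∏ q : Fin m, (if c (l.succAbove q) = 0 then (1 : MvPowerSeries (Fin (m + 1)) k)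
        else C (c (l.succAbove q)) + X q.succ) ^ e (l.succAbove q)) ≠ 0 := by
  rw [map_mul, map_pow, constantCoeff_C, map_prod]
  refine mul_ne_zero (pow_ne_zero _ hcl) (Finset.prod_ne_zero_iff.mpr fun q _ => ?_)
  rw [map_pow]
  split_ifs with h0
  · rw [map_one, one_pow]; exact one_ne_zero
  · rw [map_add, constantCoeff_C, constantCoeff_X, add_zero]; exact pow_ne_zero _ h0

open scoped Classical in
/-- The constant term of a factor of `U(e)`. -/
theorem constantCoeff_unitFactor {m : ℕ} (c : Fin (m + 1) → k) (l : Fin (m + 1)) (q : Fin m) :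
    constantCoeff (if c (l.succAbove q) = 0 then (1 : MvPowerSeries (Fin (m + 1)) k) else C (c (l.succAbove q)) + X q.succ) ≠ 0 := by
  split_ifs with h0
  · rw [map_one]; exact one_ne_zero
  · rw [map_add, constantCoeff_C, constantCoeff_X, add_zero]; exact h0

open scoped Classical in
/-- THE LOGARITHMIC COEFFICIENTS OF `U(e)`: `e_{l⁺(q)} / c_{l⁺(q)}` in `y_q` on a translated slot, `0` on the others. -/
theorem logCoeff_unitPart {m : ℕ} (c : Fin (m + 1) → k) {l : Fin (m + 1)} (hcl : c l ≠ 0) (e : Fin (m + 1) → ℕ) (q : Fin m) :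
    coeff (Finsupp.single q.succ 1) (C (c l) ^ e l * ∏ q' : Fin m, (if c (l.succAbove q') = 0 then (1 : MvPowerSeries (Fin (m + 1)) k)
        else C (c (l.succAbove q')) + X q'.succ) ^ e (l.succAbove q')) *
      (constantCoeff (C (c l) ^ e l * ∏ q' : Fin m, (if c (l.succAbove q') = 0 then (1 : MvPowerSeries (Fin (m + 1)) k)
        else C (c (l.succAbove q')) + X q'.succ) ^ e (l.succAbove q')))⁻¹ =
      if c (l.succAbove q) = 0 then 0 else (e (l.succAbove q) : k) * (c (l.succAbove q))⁻¹ := by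
  classical
  have hC : constantCoeff (C (c l) ^ e l : MvPowerSeries (Fin (m + 1)) k) ≠ 0 := by
    rw [map_pow, constantCoeff_C]; exact pow_ne_zero _ hcl
  have hW : ∀ q' : Fin m, constantCoeff ((if c (l.succAbove q') = 0 then (1 : MvPowerSeries (Fin (m + 1)) k)
      else C (c (l.succAbove q')) + X q'.succ) ^ e (l.succAbove q')) ≠ 0 := fun q' => by
    rw [map_pow]; exact pow_ne_zero _ (constantCoeff_unitFactor c l q')
  rw [logCoeff_mul q.succ hC (by rw [map_prod]; exact Finset.prod_ne_zero_iff.mpr fun q' _ => hW q'),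
    logCoeff_pow q.succ (by rw [constantCoeff_C]; exact hcl), logCoeff_C, mul_zero, zero_add,
    logCoeff_prod q.succ Finset.univ (fun q' _ => hW q')]
  simp_rw [logCoeff_pow q.succ (constantCoeff_unitFactor c l _)]
  rw [Finset.sum_eq_single q]
  · split_ifs with h0
    · rw [coeff_one, if_neg (Finsupp.single_ne_zero.mpr one_ne_zero), zero_mul, mul_zero]
    · rw [logCoeff_C_add_X q.succ q.succ, if_pos rfl]
  · intro q' _ hq'
    split_ifs with h0
    · rw [coeff_one, if_neg (Finsupp.single_ne_zero.mpr one_ne_zero), zero_mul, mul_zero]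
    · rw [logCoeff_C_add_X q.succ q'.succ, if_neg (fun h => hq' (Fin.succ_injective _ h).symm), mul_zero]
  · exact fun h => absurd (Finset.mem_univ q) h

/-! ## 5. The determinant of the new log-Jacobian matrix -/

/-- ROW OPERATIONS: if `M′ = diag(D) · P_σ · (M with the rows `a_s · M_s` added into row `l`, `a_l = 1`)` entrywise, with all `D_t ≠ 0`,
then `det M′` is a unit as soon as `det M` is. -/
theorem isUnit_det_of_rowOps {n : Type} [Fintype n] [DecidableEq n] {M M' : Matrix n n k} (hM : IsUnit M.det)
    (σ : Equiv.Perm n) (l : n) (a : n → k) (hal : a l = 1) (D : n → k) (hD : ∀ t, D t ≠ 0)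
    (hrow : ∀ t i, M' t i = D t * (M.updateRow l (∑ s, a s • M s)) (σ t) i) : IsUnit M'.det := by
  have hM' : M' = Matrix.diagonal D * (M.updateRow l (∑ s, a s • M s)).submatrix σ id := by
    ext t i
    rw [Matrix.diagonal_mul, Matrix.submatrix_apply, hrow]
    rfl
  have hsign : IsUnit (((Equiv.Perm.sign σ : ℤˣ) : ℤ) : k) := by
    rcases Int.units_eq_one_or (Equiv.Perm.sign σ) with h | h
    · rw [h]; simp
    · rw [h]; simp
  rw [hM', Matrix.det_mul, Matrix.det_diagonal, Matrix.det_permute, Matrix.det_updateRow_sum, hal, one_smul]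
  exact (isUnit_iff_ne_zero.mpr (Finset.prod_ne_zero_iff.mpr fun t _ => hD t)).mul (hsign.mul hM)

end NCTransport

end Summit.ResolutionOfSingularities.ResolutionOfSingularities.Theorems
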